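import Mathlib

/-!
# SoloBlindWreathRank — numerical skeleton of the wreath rank bound (Theorem W4)

Solo seat `solo-HodgeConjecture-blind`, session s37. Source: HOME `work/s37/wreath-forms.md` §4–§5
(HOME = `run/shared/lean/ideation/HodgeConjecture/solo-blind/`).

Context (informal, proved on paper there). Let `X` be a K3 surface with `End_Hdg T(X) = ℚ` carrying a
COMPOSITE planar seventh-form incidence carrier `Ψ = Ψ̄ ∘ κ : C → C̄ → (ℙ²)^∨` with rational reduced
image `C̄ ≅ ℙ¹` (`κ` of degree `k`, monodromy `M`, `d̄ = deg Ψ̄ ≥ 2`). Then the monodromy of the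
incidence family is the wreath product `M ≀ S_{d̄}` (W1), the wedge map
`⊕_{i<j} H¹(C^gal) ⊗ H¹(C^gal) → H²` of the Galois closure is injective on (2,0)-forms (Wreath Lemma W2),
and the symmetrised central operators `Σ_i z^{(i)}`, `Σ_{i<j} z^{(i)} z^{(j)}` (`z ∈ Z(ℚ[M])`) put
`T(X)` inside a single isotypic pair type `{ρ, ρ′}` of `H¹(C^gal)`. Writing `a(ρ) = dim 𝕄(ρ)^{1,0}`
for the Hodge multiplicities and `m = dim 𝓡^H` (resp. `r⁺, r⁻` for the symmetric / alternating parts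
when `ρ = ρ′`), the condition `h^{2,0}(X) = 1` reads

* `m · a(ρ) · a(ρ′) = 1` if `ρ ≠ ρ′`  (`mult_one_of_prod_eq_one`), or
* `r⁺ · a(a-1)/2 + r⁻ · a(a+1)/2 = 1` if `ρ = ρ′` (`sym_alt_multiplicity`),

forcing `a = 1` (Hodge-group factor `SL₂`, `O₂` or `GL₂`, of dimension ≤ 4) or `a = 2, r⁺ = 1, r⁻ = 0`
(factor inside `Sp₄`, dimension 10); in every case `dim Hg(T) ≤ 10` (`case_table_le_ten`). By
Zarhin (Crelle 341 (1983), Thm 2.2.1; quoted in arXiv:1906.10157 Prop 2.2) `Hg(T) = SO(T_ℚ)` has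
dimension `r(r-1)/2`, so `rank T ≤ 5` (`rank_le_five_of_dim_so_le_ten`). The bound is sharp
(Kummer surface of a genus-2 Jacobian as a `V₄` double plane: `a = 2`, `Sp₄ ↠ SO₅`, `r = 5`) and it
excludes the rank-8 face `T₈` of the seventh-form programme from composite planar carriers with
rational reduced image. Only the elementary numerical steps are certified here.
-/

namespace Summit.HodgeConjecture.HodgeConjecture.Theorems.SoloBlindWreathRank

/-- STEP 5 of W4: `dim SO(r) = r(r-1)/2 ≤ 10` forces `r ≤ 5`. -/
theorem rank_le_five_of_dim_so_le_ten (r : ℕ) (h : r * (r - 1) / 2 ≤ 10) : r ≤ 5 := by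
  by_contra hr
  have h6 : 6 ≤ r := by omega
  have h30 : 30 ≤ r * (r - 1) := by
    have h5 : 5 ≤ r - 1 := by omega
    calc 30 = 6 * 5 := by norm_num
      _ ≤ r * (r - 1) := Nat.mul_le_mul h6 h5
  generalize hm : r * (r - 1) = m at h h30
  omega

/-- Converse direction used for sharpness: `r = 5` is allowed (`dim SO(5) = 10`). -/
theorem dim_so_five : 5 * (5 - 1) / 2 = 10 := by norm_num

/-- STEP 3 of W4, case `ρ ≠ ρ′`: the multiplicity equation `m · a · a′ = 1` forces
`m = a = a′ = 1`. -/
theorem mult_one_of_prod_eq_one (m a a' : ℕ) (h : m * a * a' = 1) :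
    m = 1 ∧ a = 1 ∧ a' = 1 := by
  simp only [mul_eq_one] at h
  exact ⟨h.1.1, h.1.2, h.2⟩

/-- STEP 3 of W4, case `ρ = ρ′` (real type, Hodge multiplicity `a`, symmetric multiplicity `r⁺`,
alternating multiplicity `r⁻`): `r⁺ · C(a,2) + r⁻ · C(a+1,2) = 1` forces `a = 1, r⁻ = 1` or
`a = 2, r⁺ = 1, r⁻ = 0`. -/
theorem sym_alt_multiplicity (rp rm a : ℕ)
    (h : rp * (a * (a - 1) / 2) + rm * (a * (a + 1) / 2) = 1) :
    (a = 1 ∧ rm = 1) ∨ (a = 2 ∧ rp = 1 ∧ rm = 0) := by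
  rcases a with _ | _ | _ | a
  · simp at h
  · left
    refine ⟨rfl, ?_⟩
    simpa using h
  · right
    refine ⟨rfl, ?_⟩
    norm_num at h
    omega
  · exfalso
    have hX : 3 ≤ (a + 3) * (a + 3 - 1) / 2 := by
      rw [Nat.le_div_iff_mul_le (by norm_num)]
      have : a + 3 - 1 = a + 2 := by omega
      rw [this]
      nlinarith
    have hY : 6 ≤ (a + 3) * (a + 3 + 1) / 2 := by
      rw [Nat.le_div_iff_mul_le (by norm_num)]
      nlinarith
    generalize hX' : (a + 3) * (a + 3 - 1) / 2 = X at h hX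
    generalize hY' : (a + 3) * (a + 3 + 1) / 2 = Y at h hY
    rcases rp with _ | rp
    · simp only [zero_mul, zero_add] at h
      have := (mul_eq_one.mp h).2
      omega
    · nlinarith

/-- STEP 4 of W4: the Hodge-group factors occurring are `SL₂ × SL₂ → (dim 6)`, `GL₂ (dim 4)`,
`SL₂ (dim 3)`, `O₂ (dim 1)` and, in the exceptional case `a = 2`, a subgroup of `Sp₄ (dim 10)`;
all have dimension ≤ 10. -/
theorem case_table_le_ten : ∀ x ∈ [6, 4, 3, 1, 10], x ≤ 10 := by decide

/-- The rank consequences actually used: type `{1, ρ}` over a genus-`ḡ` base gives the equation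
`m · ḡ · a = 1`, hence rank `≤ 1 · 2 · 2 = 4`; the sharp case `a = 2` gives rank `5`. -/
theorem rank_values : 1 * 2 * 2 = 4 ∧ 5 * (5 - 1) / 2 ≤ 10 ∧ ¬ (6 * (6 - 1) / 2 ≤ 10) := by
  norm_num

end Summit.HodgeConjecture.HodgeConjecture.Theorems.SoloBlindWreathRank
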